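import Literature.Geometry.Hyperkaehler.LefschetzTwistorAlgebraSO41
import HarnessLib

/-!
# The grading of `𝔞 ≅ 𝔰𝔬(4,1)` by `ad h`: degrees `−2, 0, 2` only, `𝔰𝔩₂`-triples `(e_a, h, f_a)` for all `a ≠ 0`,
# and `𝔞₀ = 𝔤 × ℝh` as Lie algebras (Looijenga–Lunts 1997 §2 (2.2), §4 (4.1), (4.2)(i)–(ii))

Topic `Literature/Geometry/Hyperkaehler`, namespace `Literature.Geometry.Hyperkaehler.IsLinearHyperkaehler`. Lane
`lit-hodgefound` (Track 2 foundations library), prover seat p06 (generation 16), self-proposed row g16-#5; sequel of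
Q1747 (`LefschetzTwistorAlgebraSO41.lean`: Verbitsky's Lie algebra `𝔞 = verbitskyAlgebra g₀ J ≅ 𝔰𝔬(4,1)` on the
graded forms `GForm E ℂ = H•(X, ℂ)` of a hyperkähler torus, its basis equivalence
`Ξ = h.verbitskyMapEquiv : ℝ³ × ℝ³ × ℝ³ × ℝ ≃ₗ[ℝ] 𝔞`, `Ξ(u, v, w, t) = L_u + Λ_v + ad λ_w + t h`, the structure
constants `soBracket`, and the POINTWISE eigen-descriptions `lie_h_eq_two_smul_iff` / `_neg_two_` / `_zero_iff`) and
of Q2129 (`LefschetzTwistorAlgebraSimple.lean`: `𝔞` simple; the `𝔰𝔩₂`-triples `(h, L_{ω_λ}, Λ_{ω_λ})`, `λ ∈ S²`,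
inside `𝔞`). Here the grading statements are made INSIDE the Lie algebra `↥𝔞` for the grading element
`hₐ = ⟨h, _⟩ ∈ 𝔞` and Mathlib's `LieAlgebra.ad ℝ 𝔞 hₐ`, `Module.End.eigenspace`, `Module.End.HasEigenvalue`.
Theorems only; no definition, no named fact, no `sorry`.

## Sources, verbatim (E. Looijenga, V. A. Lunts, *A Lie algebra attached to a projective variety*, Invent. Math.
129 (1997) 361–412 = alg-geom/9604014; held corpus text `paper:arxiv-alg-geom_9604014` p0007 L55–L92, p0009
L96–L116, p0017 L17–L60)

* §1 (Lefschetz pairs): "suppose that conversely, we are given a semisimple Lie algebra `𝔤`, a simple element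
  `h ∈ 𝔤` (in the sense of appearing as the middle element of an `𝔰𝔩₂`-triple) and an abelian subalgebra `𝔞` of
  `𝔤` such that (i) the adjoint representation of `𝔤` makes `𝔤` a Lefschetz module over `𝔞`, i.e., there is a
  rational map `f : 𝔞 → 𝔤₋₂` so that for `e` in the domain of `f`, we have an `𝔰𝔩(2)`-triple `(e, h, f_e)` and
  (ii) `𝔤` is as a Lie algebra generated by `𝔞` and the image of `f`. […] We shall call such a triple a Lefschetz
  triple and its first two items, `(𝔤, h)`, a Lefschetz pair."  "(remember that only even values of `k` occur)".
* §2 (2.1), end of proof, and **(2.2) Proposition**: "Hence `V = 𝔤` and so `𝔤` has degrees `−2`, `0` and `2`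
  only. […] Say that a Lefschetz pair `(𝔤, h)` is a Jordan–Lefschetz pair if `(𝔤, h, 𝔤₂)` is a Lefschetz triple.
  […] (2.2) Proposition. If `(𝔤, h)` is a Jordan–Lefschetz pair, then `𝔤 = 𝔤₋₂ ⊕ 𝔤₀ ⊕ 𝔤₂` and
  `U𝔤 = U𝔤₂.U𝔤₀.U𝔤₋₂`."
* §4 (4.1): "Wedging with `κ_J` defines an operator in `∧V[2m]` that we denote by `e_J`. It has the Lefschetz
  property: the corresponding degree `−2` operator `f_J` is characterized by `f_J = ⋆e_J⋆⁻¹`. This makes sense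
  for any nonzero element `a ∈ ℍ₀`: `e_a` has the Lefschetz property and `f_a = Nm(a)⁻¹ ⋆e_a⋆⁻¹`."
* §4 **(4.2) Lemma**: "(i) `(𝔤(ℍ), h)` is a Jordan–Lefschetz pair with `𝔤(ℍ)₂` canonically isomorphic to the
  vector space underlying `ℍ₀`. (ii) We have a natural isomorphism `𝔤(ℍ)₀ ≅ ℍ₀ × ℝh`, where `ℍ₀` is regarded as
  the Lie algebra of `ℍ₁`."  §4 (4.4)(ii): "the semisimple part `𝔤(ℍ)′₀` of `𝔤(ℍ)₀`".
* M. Verbitsky, *Hyperholomorphic sheaves and new examples of hyperkähler manifolds*, alg-geom/9712012, §4.2 [held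
  `paper:arxiv-alg-geom_9712012` p0017 L55–L86]: "The algebra `𝔞_ℋ` is 10-dimensional. It has the following
  basis: `L_R, Λ_R, ad R` (`R = I, J, K`) and the element `H = [L_R, Λ_R]`."

## What is formalised (pointwise, on the carrier of Q1747; `E ≠ 0` throughout, `h : IsLinearHyperkaehler g₀ J`)

Notation of the docstrings: `𝔞 = verbitskyAlgebra g₀ J`, `hₐ = ⟨countingG E, h.countingG_mem_verbitskyAlgebra⟩ ∈ 𝔞`,
`Ξ = h.verbitskyMapEquiv`, `ad hₐ = LieAlgebra.ad ℝ 𝔞 hₐ`; all brackets are taken in the Lie algebra `↥𝔞`.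

§1 Coordinates inside `𝔞`: `verbitskyMapEquiv_lie` (`[Ξ p, Ξ q] = Ξ (soBracket p q)`), `verbitskyMapEquiv_unit_t`
(`Ξ(0,0,0,1) = hₐ`), `lie_h_verbitskyMapEquiv` (`[hₐ, Ξ(u,v,w,t)] = Ξ(2u, −2v, 0, 0)`), `coe_verbitskyMapEquiv`.
§2 **(2.2) for `(𝔞, h)`: degrees `−2, 0, 2` only.** `lie_h_lie_h_lie_h` (`ad(hₐ)³ T = 4 ad(hₐ) T`),
**`ad_h_pow_three : (ad hₐ)^3 = 4 • ad hₐ`** (the polynomial `X(X − 2)(X + 2)` kills `ad hₐ`),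
`mem_eigenspace_ad_h_iff`, `verbitskyMapEquiv_mem_eigenspace_ad_h_iff` (the eigen-equation in coordinates),
**`hasEigenvalue_ad_h_iff : (ad hₐ).HasEigenvalue μ ↔ μ = −2 ∨ μ = 0 ∨ μ = 2`** (`eq_of_hasEigenvalue_ad_h`,
`eigenspace_ad_h_eq_bot` for every other `μ`), the three pieces **`mem_eigenspace_ad_h_two_iff`**
(`𝔞₂ = {L_u} ≅ ℍ₀`, "(i) … canonically isomorphic to the vector space underlying `ℍ₀`"), **`mem_eigenspace_ad_h_neg_two_iff`**
(`𝔞₋₂ = {Λ_v}`), **`mem_eigenspace_ad_h_zero_iff`** (`𝔞₀ = {ad λ_w + t h}`), and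
**`iSup_eigenspace_ad_h_eq_top : ⨆ μ, eigenspace (ad hₐ) μ = ⊤`** — `𝔞 = 𝔞₋₂ ⊕ 𝔞₀ ⊕ 𝔞₂` (the sum of eigenspaces of
distinct eigenvalues is direct by Mathlib's `Module.End.eigenspaces_iSupIndep`).
§3 **(4.1) for every nonzero `a ∈ ℍ₀`:** `lefschetzDualG_twistor_eq_smul` (`f_a := Λ_{ω_{λ_a}} = Nm(a)⁻¹ Λ_a`, with
Q1747's linear `Λ_a = h.lefschetzDualTwistor a = |a|² Λ_{ω_{λ_a}}`), `lefschetzDualG_twistor_mem` (`f_a ∈ 𝔞`), and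
**`isSl2Triple_of_ne_zero : IsSl2Triple hₐ ⟨e_a, _⟩ ⟨f_a, _⟩`** in `𝔞` for ALL `a ≠ 0` (Q2129 had `|a| = 1`): with
Q1747's `lie_L_L` (`𝔞₂` abelian) and the definition of `𝔞` as generated by the `e`'s and `f`'s, this is the
Lefschetz-triple property of `(𝔞, h, 𝔞₂)` — "(`𝔤(ℍ), h`) is a Jordan–Lefschetz pair".
§4 **(4.2)(ii) as Lie algebras, `𝔞₀ = 𝔤 × ℝh`:** `exists_eq_verbitskyMapEquiv_of_lie_h_eq_zero` (degree `0` ⇒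
`T = Ξ(0,0,w,t)`), `lie_h_verbitskyMapEquiv_zero_zero`, `verbitskyMapEquiv_zero_zero_lie`
(`[Ξ(0,0,w,t), Ξ(0,0,w′,t′)] = Ξ(0,0,−2 w×w′,0)`: `h` is central in `𝔞₀` and `ℍ₀ ≅ (ℝ³, ×)`),
**`coe_lie_mem_isotropyAlgebra_of_lie_h_eq_zero`** (`[𝔞₀, 𝔞₀] ⊆ 𝔤 = isotropyAlgebra J`),
**`exists_lie_eq_adTwistor`** (every `ad λ_y` IS a bracket of two elements of `𝔤 ⊆ 𝔞₀`, so `[𝔞₀, 𝔞₀] = 𝔤` is "the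
semisimple part `𝔤(ℍ)′₀`" — semisimple by Q2129 `isSimple_isotropyAlgebra`), and
**`forall_lie_eq_zero_iff_of_lie_h_eq_zero`** (the centre of `𝔞₀` is exactly `ℝh`).

SCOPE NOTE (faithfulness). "Jordan–Lefschetz pair" is not introduced as a Lean structure; the file proves its
constituents for `(𝔞, h)` as listed (semisimplicity and simplicity are Q2129's `isSemisimple_verbitskyAlgebra`,
`isSimple_verbitskyAlgebra`; `[e_a, e_b] = 0` is Q1747's `lie_L_L`). The second half of (2.2),
`U𝔤 = U𝔤₂.U𝔤₀.U𝔤₋₂`, and the integration clause of (4.2)(ii) are not formalised here (the latter is the tree's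
`IsotropyGroupInvariance.lean` / `IsotropyGroupExponential.lean`, degreewise).

## References

* [LooijengaLunts1997] E. Looijenga, V. A. Lunts, *A Lie algebra attached to a projective variety*, Invent. Math.
  129 (1997) 361–412, §1 (Lefschetz pairs), §2 (2.1)–(2.2), §4 (4.1), (4.2) (i)–(ii), (4.4) (ii).
* [Verbitsky1997HyperholomorphicSheaves] M. Verbitsky, *Hyperholomorphic sheaves and new examples of hyperkähler
  manifolds*, alg-geom/9712012, §4.2 (the basis `L_R, Λ_R, ad R, H` of `𝔞_ℋ ≅ 𝔰𝔬(4,1)`).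
* [Huybrechts2005] D. Huybrechts, *Complex Geometry*, Springer (2005), Prop. 1.2.26, Cor. 1.2.27 (the `𝔰𝔩₂`-triple
  `(L, Λ, H)` of a Kähler form).
* [BrockerTomDieck1985] T. Bröcker, T. tom Dieck, *Representations of Compact Lie Groups*, GTM 98 (1985), Ch. I §2
  Exercise 8 (`𝔰𝔬(3) ≅ (ℝ³, ×)`).
-/

noncomputable section

open Module Function
open Literature.LinearAlgebra.Alternating
open scoped Matrix

namespace Literature.Geometry.Hyperkaehler

namespace IsLinearHyperkaehler

open LieAlgebra Literature.Geometry.Kaehler Literature.Geometry.Kaehler.ComplexTorus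

variable {E : Type*} [NormedAddCommGroup E] [NormedSpace ℂ E] [FiniteDimensional ℂ E]
  {g₀ : E →L[ℝ] E →L[ℝ] ℝ} {J : E →L[ℝ] E}

/-! ## §1 Coordinates inside `𝔞`: the basis equivalence `Ξ` and the bracket -/

/-- **`[Ξ p, Ξ q] = Ξ (soBracket p q)` in the Lie algebra `𝔞`**: Q1747's multiplication table `lie_verbitskyMap`, read
inside `↥𝔞` through the basis equivalence `Ξ = h.verbitskyMapEquiv`.
[cite: Verbitsky1997HyperholomorphicSheaves, §4.2] [cite: LooijengaLunts1997, §4 (4.2) (iii)] -/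
theorem verbitskyMapEquiv_lie [Nontrivial E] (h : IsLinearHyperkaehler g₀ J)
    (p q : (Fin 3 → ℝ) × (Fin 3 → ℝ) × (Fin 3 → ℝ) × ℝ) :
    ⁅h.verbitskyMapEquiv p, h.verbitskyMapEquiv q⁆ = h.verbitskyMapEquiv (soBracket p q) := by
  apply Subtype.ext
  -- (the ambient bracket on `𝔤𝔩(H•(X, ℂ))` is Mathlib's non-instance commutator Lie ring, baked into the type of `𝔞`;
  -- the placeholder `(_)` lets `coe_bracket` read it off by unification)
  rw [@LieSubalgebra.coe_bracket ℝ _ _ (_) _ (verbitskyAlgebra g₀ J), verbitskyMapEquiv_apply_coe,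
    verbitskyMapEquiv_apply_coe, verbitskyMapEquiv_apply_coe, h.lie_verbitskyMap]

/-- `Ξ(0, 0, 0, 1) = h`, the grading element as a member of `𝔞`. [cite: Verbitsky1997HyperholomorphicSheaves, §4.2 ("and the element H")] -/
theorem verbitskyMapEquiv_unit_t [Nontrivial E] (h : IsLinearHyperkaehler g₀ J) :
    h.verbitskyMapEquiv (0, 0, 0, 1) = ⟨countingG E, h.countingG_mem_verbitskyAlgebra⟩ := by
  apply Subtype.ext
  rw [verbitskyMapEquiv_apply_coe, verbitskyMap_apply]
  simp only [map_zero, zero_add, one_smul]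

/-- **`[h, Ξ(u, v, w, t)] = Ξ(2u, −2v, 0, 0)` inside `𝔞`**: `h` grades `𝔞` with `L` in degree `2`, `Λ` in degree
`−2`, `ad λ_w` and `h` in degree `0`. [cite: LooijengaLunts1997, §1 and §4 (4.2) (i)–(ii)] -/
theorem lie_h_verbitskyMapEquiv [Nontrivial E] (h : IsLinearHyperkaehler g₀ J)
    (p : (Fin 3 → ℝ) × (Fin 3 → ℝ) × (Fin 3 → ℝ) × ℝ) :
    ⁅(⟨countingG E, h.countingG_mem_verbitskyAlgebra⟩ : verbitskyAlgebra g₀ J), h.verbitskyMapEquiv p⁆ =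
      h.verbitskyMapEquiv ((2 : ℝ) • p.1, (-2 : ℝ) • p.2.1, 0, 0) := by
  apply Subtype.ext
  rw [@LieSubalgebra.coe_bracket ℝ _ _ (_) _ (verbitskyAlgebra g₀ J), verbitskyMapEquiv_apply_coe,
    verbitskyMapEquiv_apply_coe]
  exact h.lie_h_verbitskyMap p

/-- `Ξ(u, v, w, t) = L_u + Λ_v + ad λ_w + t h` as an endomorphism of `H•(X, ℂ)`.
[cite: Verbitsky1997HyperholomorphicSheaves, §4.2] -/
theorem coe_verbitskyMapEquiv [Nontrivial E] (h : IsLinearHyperkaehler g₀ J) (u v w : Fin 3 → ℝ) (t : ℝ) :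
    (h.verbitskyMapEquiv (u, v, w, t) : Module.End ℂ (GForm E ℂ)) =
      lefschetzTwistor g₀ J u + h.lefschetzDualTwistor v + adTwistor J w + t • countingG E := by
  rw [verbitskyMapEquiv_apply_coe, verbitskyMap_apply]

/-! ## §2 Looijenga–Lunts (2.2) for `(𝔞, h)`: `ad h` has the eigenvalues `−2, 0, 2` only and
`𝔞 = 𝔞₋₂ ⊕ 𝔞₀ ⊕ 𝔞₂` -/

/-- **`ad(h)³ = 4 ad(h)` on `𝔞`**, elementwise: `[h,[h,[h,T]]] = 4[h,T]` for every `T ∈ 𝔞` — the polynomial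
`X(X − 2)(X + 2)` annihilates `ad h` ("`𝔤` has degrees `−2`, `0` and `2` only"). [cite: LooijengaLunts1997, §2 (2.1)–(2.2)] -/
theorem lie_h_lie_h_lie_h [Nontrivial E] (h : IsLinearHyperkaehler g₀ J) (T : verbitskyAlgebra g₀ J) :
    ⁅(⟨countingG E, h.countingG_mem_verbitskyAlgebra⟩ : verbitskyAlgebra g₀ J),
      ⁅(⟨countingG E, h.countingG_mem_verbitskyAlgebra⟩ : verbitskyAlgebra g₀ J),
        ⁅(⟨countingG E, h.countingG_mem_verbitskyAlgebra⟩ : verbitskyAlgebra g₀ J), T⁆⁆⁆ =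
      4 • ⁅(⟨countingG E, h.countingG_mem_verbitskyAlgebra⟩ : verbitskyAlgebra g₀ J), T⁆ := by
  obtain ⟨p, rfl⟩ := h.verbitskyMapEquiv.surjective T
  rw [lie_h_verbitskyMapEquiv, lie_h_verbitskyMapEquiv, lie_h_verbitskyMapEquiv, ← map_nsmul]
  congr 1
  obtain ⟨u, v, w, t⟩ := p
  ext i <;> simp <;> ring

-- (the real scalar action on `Module.End ℝ ↥𝔞` in the statement is found through the subalgebra's module structure;
-- the instance search is deep, whence the raised instance budget for this one declaration)
set_option synthInstance.maxHeartbeats 200000 in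
/-- **`(ad h)³ = 4 · ad h` in `End(𝔞)`**: the minimal polynomial of the grading element divides `X(X − 2)(X + 2)`,
i.e. `(𝔞, h)` "has degrees `−2`, `0` and `2` only". [cite: LooijengaLunts1997, §2 (2.1)–(2.2)] -/
theorem ad_h_pow_three [Nontrivial E] (h : IsLinearHyperkaehler g₀ J) :
    LieAlgebra.ad ℝ (verbitskyAlgebra g₀ J) ⟨countingG E, h.countingG_mem_verbitskyAlgebra⟩ ^ 3 =
      (4 : ℝ) • LieAlgebra.ad ℝ (verbitskyAlgebra g₀ J) ⟨countingG E, h.countingG_mem_verbitskyAlgebra⟩ := by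
  refine LinearMap.ext fun T ↦ ?_
  obtain ⟨p, rfl⟩ := h.verbitskyMapEquiv.surjective T
  simp only [pow_succ, pow_zero, one_mul, Module.End.mul_apply, LinearMap.smul_apply, LieAlgebra.ad_apply,
    h.lie_h_verbitskyMapEquiv]
  rw [← LinearEquiv.map_smul]
  congr 1
  obtain ⟨u, v, w, t⟩ := p
  ext i <;> simp <;> ring

/-- Membership in an eigenspace of `ad h` on `𝔞`, read on endomorphisms: `T ∈ 𝔞_μ ↔ [h, T] = μ T`.
[cite: LooijengaLunts1997, §1 (the grading by `h`)] -/
theorem mem_eigenspace_ad_h_iff [Nontrivial E] (h : IsLinearHyperkaehler g₀ J) (μ : ℝ) (T : verbitskyAlgebra g₀ J) :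
    T ∈ Module.End.eigenspace (LieAlgebra.ad ℝ (verbitskyAlgebra g₀ J) ⟨countingG E, h.countingG_mem_verbitskyAlgebra⟩) μ ↔
      ((⁅(⟨countingG E, h.countingG_mem_verbitskyAlgebra⟩ : verbitskyAlgebra g₀ J), T⁆ : verbitskyAlgebra g₀ J) :
        Module.End ℂ (GForm E ℂ)) = μ • (T : Module.End ℂ (GForm E ℂ)) := by
  rw [Module.End.mem_eigenspace_iff, LieAlgebra.ad_apply, Subtype.ext_iff]
  rfl

/-- **The eigen-equation in coordinates**: `Ξ(u, v, w, t) ∈ 𝔞_μ` iff `2u = μu`, `−2v = μv`, `μw = 0`, `μt = 0`.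
[cite: LooijengaLunts1997, §4 (4.2) (i)–(ii)] -/
theorem verbitskyMapEquiv_mem_eigenspace_ad_h_iff [Nontrivial E] (h : IsLinearHyperkaehler g₀ J) (μ : ℝ)
    (p : (Fin 3 → ℝ) × (Fin 3 → ℝ) × (Fin 3 → ℝ) × ℝ) :
    h.verbitskyMapEquiv p ∈
        Module.End.eigenspace (LieAlgebra.ad ℝ (verbitskyAlgebra g₀ J) ⟨countingG E, h.countingG_mem_verbitskyAlgebra⟩) μ ↔
      (2 : ℝ) • p.1 = μ • p.1 ∧ (-2 : ℝ) • p.2.1 = μ • p.2.1 ∧ μ • p.2.2.1 = 0 ∧ μ * p.2.2.2 = 0 := by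
  rw [Module.End.mem_eigenspace_iff, LieAlgebra.ad_apply, h.lie_h_verbitskyMapEquiv, ← LinearEquiv.map_smul,
    h.verbitskyMapEquiv.injective.eq_iff]
  obtain ⟨u, v, w, t⟩ := p
  simp only [Prod.smul_mk, Prod.mk.injEq, smul_eq_mul]
  constructor
  · rintro ⟨h1, h2, h3, h4⟩
    exact ⟨h1, h2, h3.symm, h4.symm⟩
  · rintro ⟨h1, h2, h3, h4⟩
    exact ⟨h1, h2, h3.symm, h4.symm⟩

/-- **The eigenvalues of `ad h` on `𝔞` lie in `{−2, 0, 2}`** ("`𝔤` has degrees `−2`, `0` and `2` only"; in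
particular "only even values of `k` occur"). [cite: LooijengaLunts1997, §2 (2.1)–(2.2), §1] -/
theorem eq_of_hasEigenvalue_ad_h [Nontrivial E] (h : IsLinearHyperkaehler g₀ J) {μ : ℝ}
    (hμ : (LieAlgebra.ad ℝ (verbitskyAlgebra g₀ J) ⟨countingG E, h.countingG_mem_verbitskyAlgebra⟩).HasEigenvalue μ) :
    μ = -2 ∨ μ = 0 ∨ μ = 2 := by
  obtain ⟨T, hT, hT0⟩ := hμ.exists_hasEigenvector
  obtain ⟨⟨u, v, w, t⟩, rfl⟩ := h.verbitskyMapEquiv.surjective T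
  rw [h.verbitskyMapEquiv_mem_eigenspace_ad_h_iff] at hT
  obtain ⟨h1, h2, h3, h4⟩ := hT
  by_contra hne
  simp only [not_or] at hne
  obtain ⟨hm2, h0, hp2⟩ := hne
  apply hT0
  rw [← (h.verbitskyMapEquiv).map_zero]
  congr 1
  have hu : u = 0 := by
    have e : (2 - μ) • u = 0 := by rw [sub_smul, h1, sub_self]
    exact (smul_eq_zero.1 e).resolve_left (sub_ne_zero.2 (Ne.symm hp2))
  have hv : v = 0 := by
    have e : (-2 - μ) • v = 0 := by rw [sub_smul, h2, sub_self]
    exact (smul_eq_zero.1 e).resolve_left (sub_ne_zero.2 (Ne.symm hm2))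
  have hw : w = 0 := (smul_eq_zero.1 h3).resolve_left h0
  have ht : t = 0 := (mul_eq_zero.1 h4).resolve_left h0
  simp only [hu, hv, hw, ht, Prod.mk_zero_zero]

/-- **The eigenvalues of `ad h` on `𝔞` are EXACTLY `−2, 0, 2`** (`E ≠ 0`: `L_{e₀}`, `h`, `Λ_{e₀}` are eigenvectors).
[cite: LooijengaLunts1997, §2 (2.2), §4 (4.2) (i)–(ii)] -/
theorem hasEigenvalue_ad_h_iff [Nontrivial E] (h : IsLinearHyperkaehler g₀ J) (μ : ℝ) :
    (LieAlgebra.ad ℝ (verbitskyAlgebra g₀ J) ⟨countingG E, h.countingG_mem_verbitskyAlgebra⟩).HasEigenvalue μ ↔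
      μ = -2 ∨ μ = 0 ∨ μ = 2 := by
  refine ⟨h.eq_of_hasEigenvalue_ad_h, ?_⟩
  have key : ∀ p : (Fin 3 → ℝ) × (Fin 3 → ℝ) × (Fin 3 → ℝ) × ℝ, p ≠ 0 →
      h.verbitskyMapEquiv p ∈ Module.End.eigenspace
        (LieAlgebra.ad ℝ (verbitskyAlgebra g₀ J) ⟨countingG E, h.countingG_mem_verbitskyAlgebra⟩) μ →
      (LieAlgebra.ad ℝ (verbitskyAlgebra g₀ J) ⟨countingG E, h.countingG_mem_verbitskyAlgebra⟩).HasEigenvalue μ :=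
    fun p hp hmem ↦ Module.End.hasEigenvalue_of_hasEigenvector
      ⟨hmem, fun e ↦ hp ((LinearEquiv.map_eq_zero_iff h.verbitskyMapEquiv).1 e)⟩
  rintro (rfl | rfl | rfl)
  · refine key (0, ![1, 0, 0], 0, 0) (fun e ↦ ?_) ?_
    · simp [Prod.ext_iff] at e
    · rw [h.verbitskyMapEquiv_mem_eigenspace_ad_h_iff]
      simp
  · refine key (0, 0, 0, 1) (fun e ↦ ?_) ?_
    · simp [Prod.ext_iff] at e
    · rw [h.verbitskyMapEquiv_mem_eigenspace_ad_h_iff]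
      simp
  · refine key (![1, 0, 0], 0, 0, 0) (fun e ↦ ?_) ?_
    · simp [Prod.ext_iff] at e
    · rw [h.verbitskyMapEquiv_mem_eigenspace_ad_h_iff]
      simp

/-- All other eigenspaces of `ad h` on `𝔞` are trivial (no degrees other than `−2, 0, 2`).
[cite: LooijengaLunts1997, §2 (2.1)–(2.2)] -/
theorem eigenspace_ad_h_eq_bot [Nontrivial E] (h : IsLinearHyperkaehler g₀ J) {μ : ℝ} (h1 : μ ≠ -2) (h2 : μ ≠ 0)
    (h3 : μ ≠ 2) :
    Module.End.eigenspace (LieAlgebra.ad ℝ (verbitskyAlgebra g₀ J) ⟨countingG E, h.countingG_mem_verbitskyAlgebra⟩) μ = ⊥ := by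
  by_contra hne
  rcases h.eq_of_hasEigenvalue_ad_h (Module.End.hasEigenvalue_iff.2 hne) with e | e | e
  · exact h1 e
  · exact h2 e
  · exact h3 e

/-- **`𝔞₂ = {L_u : u ∈ ℝ³} ≅ ℍ₀`**: the `2`-eigenspace of `ad h` in `𝔞` consists of the Lefschetz operators of the
twistor Kähler forms ("`𝔤(ℍ)₂` canonically isomorphic to the vector space underlying `ℍ₀`", `a ↦ e_a`).
[cite: LooijengaLunts1997, §4 (4.2) (i)] -/
theorem mem_eigenspace_ad_h_two_iff [Nontrivial E] (h : IsLinearHyperkaehler g₀ J) (T : verbitskyAlgebra g₀ J) :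
    T ∈ Module.End.eigenspace (LieAlgebra.ad ℝ (verbitskyAlgebra g₀ J) ⟨countingG E, h.countingG_mem_verbitskyAlgebra⟩) 2 ↔
      ∃ u : Fin 3 → ℝ, (T : Module.End ℂ (GForm E ℂ)) = lefschetzTwistor g₀ J u := by
  constructor
  · intro hT
    obtain ⟨⟨u, v, w, t⟩, rfl⟩ := h.verbitskyMapEquiv.surjective T
    rw [h.verbitskyMapEquiv_mem_eigenspace_ad_h_iff] at hT
    obtain ⟨-, hv, hw, ht⟩ := hT
    have hv0 : v = 0 := by
      have e : (4 : ℝ) • v = 0 := by linear_combination (norm := module) -hv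
      exact (smul_eq_zero.1 e).resolve_left (by norm_num)
    have hw0 : w = 0 := (smul_eq_zero.1 hw).resolve_left (by norm_num)
    have ht0 : t = 0 := (mul_eq_zero.1 ht).resolve_left (by norm_num)
    refine ⟨u, ?_⟩
    rw [coe_verbitskyMapEquiv, hv0, hw0, ht0, map_zero, map_zero, zero_smul, add_zero, add_zero, add_zero]
  · rintro ⟨u, hu⟩
    have e : T = h.verbitskyMapEquiv (u, 0, 0, 0) := Subtype.ext (by
      rw [hu, coe_verbitskyMapEquiv, map_zero, map_zero, zero_smul, add_zero, add_zero, add_zero])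
    rw [e, h.verbitskyMapEquiv_mem_eigenspace_ad_h_iff]
    simp

/-- **`𝔞₋₂ = {Λ_v : v ∈ ℝ³}`**: the `(−2)`-eigenspace of `ad h` in `𝔞` consists of the (linear) dual Lefschetz
operators `Λ_v = Nm(v) f_v`. [cite: LooijengaLunts1997, §4 (4.1)–(4.2) (i)] -/
theorem mem_eigenspace_ad_h_neg_two_iff [Nontrivial E] (h : IsLinearHyperkaehler g₀ J) (T : verbitskyAlgebra g₀ J) :
    T ∈ Module.End.eigenspace (LieAlgebra.ad ℝ (verbitskyAlgebra g₀ J) ⟨countingG E, h.countingG_mem_verbitskyAlgebra⟩) (-2) ↔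
      ∃ v : Fin 3 → ℝ, (T : Module.End ℂ (GForm E ℂ)) = h.lefschetzDualTwistor v := by
  constructor
  · intro hT
    obtain ⟨⟨u, v, w, t⟩, rfl⟩ := h.verbitskyMapEquiv.surjective T
    rw [h.verbitskyMapEquiv_mem_eigenspace_ad_h_iff] at hT
    obtain ⟨hu, -, hw, ht⟩ := hT
    have hu0 : u = 0 := by
      have e : (4 : ℝ) • u = 0 := by linear_combination (norm := module) hu
      exact (smul_eq_zero.1 e).resolve_left (by norm_num)
    have hw0 : w = 0 := (smul_eq_zero.1 hw).resolve_left (by norm_num)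
    have ht0 : t = 0 := (mul_eq_zero.1 ht).resolve_left (by norm_num)
    refine ⟨v, ?_⟩
    rw [coe_verbitskyMapEquiv, hu0, hw0, ht0, map_zero, map_zero, zero_smul, zero_add, add_zero, add_zero]
  · rintro ⟨v, hv⟩
    have e : T = h.verbitskyMapEquiv (0, v, 0, 0) := Subtype.ext (by
      rw [hv, coe_verbitskyMapEquiv, map_zero, map_zero, zero_smul, zero_add, add_zero, add_zero])
    rw [e, h.verbitskyMapEquiv_mem_eigenspace_ad_h_iff]
    simp

/-- **`𝔞₀ = {ad λ_w + t h} = 𝔤 ⊕ ℝh`**: the `0`-eigenspace of `ad h` in `𝔞`, i.e. the centraliser of `h`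
("`𝔤(ℍ)₀ ≅ ℍ₀ × ℝh`"). [cite: LooijengaLunts1997, §4 (4.2) (ii)] -/
theorem mem_eigenspace_ad_h_zero_iff [Nontrivial E] (h : IsLinearHyperkaehler g₀ J) (T : verbitskyAlgebra g₀ J) :
    T ∈ Module.End.eigenspace (LieAlgebra.ad ℝ (verbitskyAlgebra g₀ J) ⟨countingG E, h.countingG_mem_verbitskyAlgebra⟩) 0 ↔
      ∃ (w : Fin 3 → ℝ) (t : ℝ), (T : Module.End ℂ (GForm E ℂ)) = adTwistor J w + t • countingG E := by
  constructor
  · intro hT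
    obtain ⟨⟨u, v, w, t⟩, rfl⟩ := h.verbitskyMapEquiv.surjective T
    rw [h.verbitskyMapEquiv_mem_eigenspace_ad_h_iff] at hT
    obtain ⟨hu, hv, -, -⟩ := hT
    rw [zero_smul] at hu hv
    have hu0 : u = 0 := (smul_eq_zero.1 hu).resolve_left (by norm_num)
    have hv0 : v = 0 := (smul_eq_zero.1 hv).resolve_left (by norm_num)
    refine ⟨w, t, ?_⟩
    rw [coe_verbitskyMapEquiv, hu0, hv0, map_zero, map_zero, zero_add, zero_add]
  · rintro ⟨w, t, hwt⟩
    have e : T = h.verbitskyMapEquiv (0, 0, w, t) := Subtype.ext (by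
      rw [hwt, coe_verbitskyMapEquiv, map_zero, map_zero, zero_add, zero_add])
    rw [e, h.verbitskyMapEquiv_mem_eigenspace_ad_h_iff]
    simp
set_option maxHeartbeats 400000 in -- buildfix (bf3-g31): 160k/180k FAIL, 200k PASS at accept time; line-neutral budget line
/-- **(2.2) for `(𝔞, h)`: `𝔞 = 𝔞₋₂ ⊕ 𝔞₀ ⊕ 𝔞₂`** — the eigenspaces of `ad h` span `𝔞` (`ad h` is diagonalisable;
the sum is direct by `Module.End.eigenspaces_iSupIndep`): `Ξ(u,v,w,t) = Ξ(u,0,0,0) + Ξ(0,0,w,t) + Ξ(0,v,0,0)`.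
[cite: LooijengaLunts1997, §2 (2.2) ("𝔤 = 𝔤₋₂ ⊕ 𝔤₀ ⊕ 𝔤₂")] -/
theorem iSup_eigenspace_ad_h_eq_top [Nontrivial E] (h : IsLinearHyperkaehler g₀ J) :
    ⨆ μ : ℝ, Module.End.eigenspace (LieAlgebra.ad ℝ (verbitskyAlgebra g₀ J) ⟨countingG E, h.countingG_mem_verbitskyAlgebra⟩) μ = ⊤ := by
  rw [eq_top_iff]
  rintro T -
  obtain ⟨⟨u, v, w, t⟩, rfl⟩ := h.verbitskyMapEquiv.surjective T
  have e : h.verbitskyMapEquiv (u, v, w, t) =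
      h.verbitskyMapEquiv (u, 0, 0, 0) + h.verbitskyMapEquiv (0, 0, w, t) + h.verbitskyMapEquiv (0, v, 0, 0) := by
    rw [← map_add, ← map_add]
    congr 1
    simp
  rw [e]
  refine add_mem (add_mem ?_ ?_) ?_
  · refine Submodule.mem_iSup_of_mem (2 : ℝ) ?_
    rw [h.verbitskyMapEquiv_mem_eigenspace_ad_h_iff]
    simp
  · refine Submodule.mem_iSup_of_mem (0 : ℝ) ?_
    rw [h.verbitskyMapEquiv_mem_eigenspace_ad_h_iff]
    simp
  · refine Submodule.mem_iSup_of_mem (-2 : ℝ) ?_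
    rw [h.verbitskyMapEquiv_mem_eigenspace_ad_h_iff]
    simp

/-! ## §3 Looijenga–Lunts (4.1): the `𝔰𝔩₂`-triples `(e_a, h, f_a)`, `f_a = Nm(a)⁻¹ Λ_a`, for EVERY `a ≠ 0` -/

/-- **`f_a := Λ_{ω_{λ_a}} = Nm(a)⁻¹ Λ_a`** for `a ≠ 0` (Q1747's linear `Λ_a = |a|² Λ_{ω_{λ_a}}`; "`f_a = Nm(a)⁻¹ ⋆e_a⋆⁻¹`").
[cite: LooijengaLunts1997, §4 (4.1)] -/
theorem lefschetzDualG_twistor_eq_smul [Nontrivial E] (h : IsLinearHyperkaehler g₀ J) {a : Fin 3 → ℝ} (ha : a ≠ 0) :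
    lefschetzDualG (fundamentalForm g₀ (a 0 • opI E + a 1 • J + a 2 • opK J)) =
      (a 0 ^ 2 + a 1 ^ 2 + a 2 ^ 2)⁻¹ • h.lefschetzDualTwistor a := by
  have hn : a 0 ^ 2 + a 1 ^ 2 + a 2 ^ 2 ≠ 0 := by
    intro h0
    apply ha
    have h0' : ∀ i : Fin 3, a i = 0 := by
      intro i
      fin_cases i <;> simp only [Fin.zero_eta, Fin.mk_one, Fin.reduceFinMk] <;>
        nlinarith [sq_nonneg (a 0), sq_nonneg (a 1), sq_nonneg (a 2)]
    exact funext h0'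
  rw [h.lefschetzDualTwistor_eq_smul, smul_smul, inv_mul_cancel₀ hn, one_smul]

/-- `f_a = Λ_{ω_{λ_a}} ∈ 𝔞` for every `a ≠ 0` (it is `Nm(a)⁻¹ Λ_a = Λ_{Nm(a)⁻¹ a}`). [cite: LooijengaLunts1997, §4 (4.1)] -/
theorem lefschetzDualG_twistor_mem [Nontrivial E] (h : IsLinearHyperkaehler g₀ J) {a : Fin 3 → ℝ} (ha : a ≠ 0) :
    lefschetzDualG (fundamentalForm g₀ (a 0 • opI E + a 1 • J + a 2 • opK J)) ∈ verbitskyAlgebra g₀ J := by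
  rw [h.lefschetzDualG_twistor_eq_smul ha, ← map_smul]
  exact h.lefschetzDualTwistor_mem _

/-- **Looijenga–Lunts (4.1): `(e_a, h, f_a)` is an `𝔰𝔩₂`-triple in `𝔞` for EVERY nonzero `a ∈ ℍ₀`** ("This makes
sense for any nonzero element `a ∈ ℍ₀`: `e_a` has the Lefschetz property and `f_a = Nm(a)⁻¹ ⋆e_a⋆⁻¹`"), with
`e_a = L_a = L_{ω_{λ_a}}` and `f_a = Λ_{ω_{λ_a}}`: `[e_a, f_a] = h`, `[h, e_a] = 2e_a`, `[h, f_a] = −2f_a`, `h ≠ 0` — the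
tree's `ComplexTorus.isSl2Triple` of the non-degenerate form `ω_{λ_a}` (Huybrechts Cor. 1.2.27), read inside `𝔞`;
Q2129's `isSl2Triple_verbitskyAlgebra` is the case `Nm(a) = 1`. This is the Lefschetz-triple property (i) of
`(𝔞, h, 𝔞₂)`. [cite: LooijengaLunts1997, §1 (Lefschetz triples) and §4 (4.1), (4.2) (i)] [cite: Huybrechts2005, Cor. 1.2.27] -/
theorem isSl2Triple_of_ne_zero [Nontrivial E] (h : IsLinearHyperkaehler g₀ J) {a : Fin 3 → ℝ} (ha : a ≠ 0) :
    IsSl2Triple (⟨countingG E, h.countingG_mem_verbitskyAlgebra⟩ : verbitskyAlgebra g₀ J)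
      ⟨lefschetzTwistor g₀ J a, lefschetzTwistor_mem a⟩
      ⟨lefschetzDualG (fundamentalForm g₀ (a 0 • opI E + a 1 • J + a 2 • opK J)), h.lefschetzDualG_twistor_mem ha⟩ := by
  have t := ComplexTorus.isSl2Triple (h.fundamentalForm_twistor_nondegenerate ha)
  -- (as in Q2129: the `(_)` placeholders let the ambient non-instance Lie ring be read off `t` by unification)
  exact ⟨fun h0 ↦ @IsSl2Triple.h_ne_zero _ (_) _ _ _ t (congrArg Subtype.val h0),
    Subtype.ext (@IsSl2Triple.lie_e_f _ (_) _ _ _ t), Subtype.ext (@IsSl2Triple.lie_h_e_nsmul _ (_) _ _ _ t),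
    Subtype.ext (@IsSl2Triple.lie_h_f_nsmul _ (_) _ _ _ t)⟩

/-! ## §4 Looijenga–Lunts (4.2)(ii) as Lie algebras: `𝔞₀ = 𝔤 × ℝh`, `[𝔞₀, 𝔞₀] = 𝔤`, centre `ℝh` -/

/-- An element of `𝔞` of degree `0` is `Ξ(0, 0, w, t) = ad λ_w + t h`. [cite: LooijengaLunts1997, §4 (4.2) (ii)] -/
theorem exists_eq_verbitskyMapEquiv_of_lie_h_eq_zero [Nontrivial E] (h : IsLinearHyperkaehler g₀ J)
    {T : verbitskyAlgebra g₀ J}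
    (hT : ⁅(⟨countingG E, h.countingG_mem_verbitskyAlgebra⟩ : verbitskyAlgebra g₀ J), T⁆ = 0) :
    ∃ (w : Fin 3 → ℝ) (t : ℝ), T = h.verbitskyMapEquiv (0, 0, w, t) := by
  obtain ⟨⟨u, v, w, t⟩, rfl⟩ := h.verbitskyMapEquiv.surjective T
  rw [h.lie_h_verbitskyMapEquiv, LinearEquiv.map_eq_zero_iff] at hT
  simp only [Prod.mk_eq_zero, smul_eq_zero, OfNat.ofNat_ne_zero, neg_eq_zero, false_or, and_true] at hT
  obtain ⟨rfl, rfl⟩ := hT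
  exact ⟨w, t, rfl⟩

/-- `Ξ(0, 0, w, t)` has degree `0`: `[h, ad λ_w + t h] = 0`. [cite: LooijengaLunts1997, §4 (4.2) (ii)] -/
theorem lie_h_verbitskyMapEquiv_zero_zero [Nontrivial E] (h : IsLinearHyperkaehler g₀ J) (w : Fin 3 → ℝ) (t : ℝ) :
    ⁅(⟨countingG E, h.countingG_mem_verbitskyAlgebra⟩ : verbitskyAlgebra g₀ J), h.verbitskyMapEquiv (0, 0, w, t)⁆ = 0 := by
  rw [h.lie_h_verbitskyMapEquiv, smul_zero, smul_zero, Prod.mk_zero_zero, Prod.mk_zero_zero, Prod.mk_zero_zero,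
    LinearEquiv.map_zero]

/-- **The bracket on `𝔞₀`: `[ad λ_w + t h, ad λ_{w′} + t′ h] = −2 ad λ_{w×w′}`** — `h` is central in `𝔞₀` and the
`ad λ` close up under the cross product (`ℍ₀ ≅ (ℝ³, ×)` "regarded as the Lie algebra of `ℍ₁`").
[cite: LooijengaLunts1997, §4 (4.2) (ii)] [cite: BrockerTomDieck1985, Ch. I §2 Exercise 8] -/
theorem verbitskyMapEquiv_zero_zero_lie [Nontrivial E] (h : IsLinearHyperkaehler g₀ J) (w w' : Fin 3 → ℝ) (t t' : ℝ) :
    ⁅h.verbitskyMapEquiv (0, 0, w, t), h.verbitskyMapEquiv (0, 0, w', t')⁆ =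
      h.verbitskyMapEquiv (0, 0, (-2 : ℝ) • (w ⨯₃ w'), 0) := by
  rw [h.verbitskyMapEquiv_lie]
  congr 1
  simp only [soBracket, map_zero, smul_zero, zero_sub, add_zero, dotProduct_zero, sub_self, neg_smul]

/-- **`[𝔞₀, 𝔞₀] ⊆ 𝔤`**: the bracket of two degree-`0` elements of `𝔞` lies in Verbitsky's isotropy algebra
`𝔤 = isotropyAlgebra J` (the `ℝh`-component drops out). [cite: LooijengaLunts1997, §4 (4.2) (ii), (4.4) (ii) ("the semisimple part 𝔤(ℍ)′₀")] -/
theorem coe_lie_mem_isotropyAlgebra_of_lie_h_eq_zero [Nontrivial E] (h : IsLinearHyperkaehler g₀ J)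
    {T T' : verbitskyAlgebra g₀ J}
    (hT : ⁅(⟨countingG E, h.countingG_mem_verbitskyAlgebra⟩ : verbitskyAlgebra g₀ J), T⁆ = 0)
    (hT' : ⁅(⟨countingG E, h.countingG_mem_verbitskyAlgebra⟩ : verbitskyAlgebra g₀ J), T'⁆ = 0) :
    ((⁅T, T'⁆ : verbitskyAlgebra g₀ J) : Module.End ℂ (GForm E ℂ)) ∈ isotropyAlgebra J := by
  obtain ⟨w, t, rfl⟩ := h.exists_eq_verbitskyMapEquiv_of_lie_h_eq_zero hT
  obtain ⟨w', t', rfl⟩ := h.exists_eq_verbitskyMapEquiv_of_lie_h_eq_zero hT'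
  rw [h.verbitskyMapEquiv_zero_zero_lie, coe_verbitskyMapEquiv, map_zero, map_zero, zero_smul, zero_add, zero_add,
    add_zero]
  exact adTwistor_mem_isotropyAlgebra _

/-- A vector with vanishing cross products against `e₀` and `e₁` is zero. [folklore] -/
private theorem eq_zero_of_cross_e₀_e₁ {w : Fin 3 → ℝ} (h0 : w ⨯₃ ![1, 0, 0] = 0) (h1 : w ⨯₃ ![0, 1, 0] = 0) :
    w = 0 := by
  have e0 := congr_fun h0 1
  have e1 := congr_fun h0 2
  have e2 := congr_fun h1 2
  simp [cross_apply] at e0 e1 e2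
  ext i
  fin_cases i
  · exact e2
  · simpa using e1
  · exact e0

/-- **`𝔤 ⊆ [𝔞₀, 𝔞₀]`, indeed `𝔤 = [𝔤, 𝔤]` elementwise**: every `ad λ_y` IS the bracket of two degree-`0` elements
`ad λ_w, ad λ_{w′}` of `𝔞` (for `y ≠ 0`: `w ⊥ y` nonzero and `w′ = −(2|w|²)⁻¹ y × w`, so that `−2 w × w′ = y`). With
`coe_lie_mem_isotropyAlgebra_of_lie_h_eq_zero`: `[𝔞₀, 𝔞₀] = 𝔤` is "the semisimple part `𝔤(ℍ)′₀` of `𝔤(ℍ)₀`"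
(semisimple, indeed simple, by Q2129). [cite: LooijengaLunts1997, §4 (4.2) (ii), (4.4) (ii)] -/
theorem exists_lie_eq_adTwistor [Nontrivial E] (h : IsLinearHyperkaehler g₀ J) (y : Fin 3 → ℝ) :
    ∃ w w' : Fin 3 → ℝ,
      ((⁅h.verbitskyMapEquiv (0, 0, w, 0), h.verbitskyMapEquiv (0, 0, w', 0)⁆ : verbitskyAlgebra g₀ J) :
        Module.End ℂ (GForm E ℂ)) = adTwistor J y := by
  suffices H : ∃ w w' : Fin 3 → ℝ, (-2 : ℝ) • (w ⨯₃ w') = y by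
    obtain ⟨w, w', e⟩ := H
    refine ⟨w, w', ?_⟩
    rw [h.verbitskyMapEquiv_zero_zero_lie, coe_verbitskyMapEquiv, e, map_zero, map_zero, zero_smul, zero_add, zero_add,
      add_zero]
  by_cases hy : y = 0
  · exact ⟨0, 0, by rw [hy, cross_self, smul_zero]⟩
  -- a nonzero vector `w` orthogonal to `y`
  obtain ⟨w, hw0, hwy⟩ : ∃ w : Fin 3 → ℝ, w ≠ 0 ∧ y ⬝ᵥ w = 0 := by
    by_cases h0 : y ⨯₃ ![1, 0, 0] = 0
    · by_cases h1 : y ⨯₃ ![0, 1, 0] = 0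
      · exact absurd (eq_zero_of_cross_e₀_e₁ h0 h1) hy
      · exact ⟨_, h1, dot_self_cross y _⟩
    · exact ⟨_, h0, dot_self_cross y _⟩
  have hn : w ⬝ᵥ w ≠ 0 := fun e ↦ hw0 (dotProduct_self_eq_zero.1 e)
  refine ⟨w, (-(2 * (w ⬝ᵥ w))⁻¹) • (y ⨯₃ w), ?_⟩
  rw [LinearMap.map_smul, cross_cross_eq_smul_sub_smul', hwy, zero_smul, sub_zero, smul_smul, smul_smul]
  have e : ((-2 : ℝ) * -(2 * w ⬝ᵥ w)⁻¹ * w ⬝ᵥ w) = 1 := by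
    field_simp
  rw [e, one_smul]

/-- **The centre of `𝔞₀` is `ℝh`**: a degree-`0` element of `𝔞` commutes with all of `𝔞₀` iff it is a multiple
of `h` (`𝔞₀ = 𝔤 × ℝh` with `𝔤 ≅ 𝔰𝔲(2)` centreless). [cite: LooijengaLunts1997, §4 (4.2) (ii)]
[cite: Verbitsky1997HyperholomorphicSheaves, §4.2] -/
theorem forall_lie_eq_zero_iff_of_lie_h_eq_zero [Nontrivial E] (h : IsLinearHyperkaehler g₀ J)
    {T : verbitskyAlgebra g₀ J}
    (hT : ⁅(⟨countingG E, h.countingG_mem_verbitskyAlgebra⟩ : verbitskyAlgebra g₀ J), T⁆ = 0) :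
    (∀ T' : verbitskyAlgebra g₀ J,
        ⁅(⟨countingG E, h.countingG_mem_verbitskyAlgebra⟩ : verbitskyAlgebra g₀ J), T'⁆ = 0 → ⁅T, T'⁆ = 0) ↔
      ∃ t : ℝ, (T : Module.End ℂ (GForm E ℂ)) = t • countingG E := by
  obtain ⟨w, t, rfl⟩ := h.exists_eq_verbitskyMapEquiv_of_lie_h_eq_zero hT
  constructor
  · intro H
    have k : ∀ w' : Fin 3 → ℝ, w ⨯₃ w' = 0 := by
      intro w'
      have e := H (h.verbitskyMapEquiv (0, 0, w', 0)) (h.lie_h_verbitskyMapEquiv_zero_zero w' 0)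
      rw [h.verbitskyMapEquiv_zero_zero_lie, LinearEquiv.map_eq_zero_iff] at e
      simp only [Prod.mk_eq_zero, smul_eq_zero, neg_eq_zero, OfNat.ofNat_ne_zero, false_or, true_and, and_true] at e
      exact e
    have hw : w = 0 := eq_zero_of_cross_e₀_e₁ (k _) (k _)
    refine ⟨t, ?_⟩
    rw [coe_verbitskyMapEquiv, hw, map_zero, map_zero, map_zero, zero_add, zero_add, zero_add]
  · rintro ⟨t', e⟩ T' hT'
    obtain ⟨w', t'', rfl⟩ := h.exists_eq_verbitskyMapEquiv_of_lie_h_eq_zero hT'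
    have hw : w = 0 := by
      rw [coe_verbitskyMapEquiv, map_zero, map_zero, zero_add, zero_add] at e
      have e2 : adTwistor J w = (t' - t) • countingG E := by linear_combination (norm := module) e
      exact (h.adTwistor_eq_smul_countingG e2).1
    rw [h.verbitskyMapEquiv_zero_zero_lie, hw, map_zero, LinearMap.zero_apply, smul_zero, Prod.mk_zero_zero,
      Prod.mk_zero_zero, Prod.mk_zero_zero, LinearEquiv.map_zero]

end IsLinearHyperkaehler

end Literature.Geometry.Hyperkaehler

end
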